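import Summits.NavierStokesRegularity.NavierStokesRegularity.Theorems.CorkscrewDynamoCorkscrewProfileCoRotationNecessity
import Summits.NavierStokesRegularity.NavierStokesRegularity.Theorems.CorkscrewDynamoCorkscrewProfileRotatingWaveProfileEq
import Summits.NavierStokesRegularity.NavierStokesRegularity.Theorems.CorkscrewDynamoCorkscrewProfileTypeIPressureGrowth
import Summits.NavierStokesRegularity.NavierStokesRegularity.Theorems.CorkscrewDynamoCorkscrewProfileRssDataClassical
import Literature.Analysis.FluidPDE.PineauVicolRDSSLeray
import HarnessLib

/-!
# Route CorkscrewDynamo · crux `CorkscrewProfile` (stmt-NavierStokesRegularity-11282) — every RSS profile is a rotated Leray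
# profile and has CO-ROTATING vertical vorticity somewhere

Line `registered`, lead c5, wave 2 (2026-08-17): assembly of the tool stubs T8 `stub_rotatingWaveProfileEq` (p168911), T9
`stub_typeIPressureGrowth` (p168986), T10 `stub_rssDataClassical` (p168961) with the co-rotation theorem of wave 1
(`rotatedLerayProfile_eq_zero_of_trace_nonneg`, p168449) into the registered theorem T11
`rssProfileExists_rotatedLerayProfile`, stated in the vocabulary of the line's single OPEN stub — item
stmt-NavierStokesRegularity-16274 `FilamentSkeletonRss.RssProfileExists` (= ¬ Pineau–Vicol 2026 Conj. 1.1 = Tsai Conj. 8.9):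

* `rssData_rotatedLerayProfile` — from the DATA of `RssProfileExists` (`U ∈ C²`, `Rot` pinned on the basis, `u` ancient mild with
  measurable slices, Type-I constant `C₀`, `u(−1) = U`, rotated DSS for EVERY factor `c > 0` through `Rot(−2α log c)`) the slice
  `U` is smooth, divergence free, obeys `‖U y‖ ≤ C₀/(1+‖y‖)`, and solves Perelman's ROTATED LERAY PROFILE SYSTEM
  `α(JU − DU[Jy]) + ½U + ½DU[y] − ΔU + DU[U] + ∇P = 0` for a smooth pressure of POLYNOMIAL growth (the slice `q(−1)` of the
  classical pressure of the Oseen-gauge representative, which coincides with the ansatz field `pvAnsatz α U`; the rotating wave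
  `lerayOrbit` differentiated at `s = 0`; Pineau–Vicol's pressure identification, potential gradient bound and cylinder regularity);
* `rotatedLerayProfile_eq_zero_of_counterRotating_poly` — wave 1's co-rotation theorem with polynomially bounded pressure;
* `rssData_exists_corotating_vorticity`, `rssProfileExists_rotatedLerayProfile` — hence every witness of `RssProfileExists` has a
  point where `α · (curl U)₃ > 0`: its vertical vorticity co-rotates with the pattern somewhere (indeed, by
  `rotatedLerayProfile_vorticity_on_corotationSphere`, its vorticity enters the open ball `B(αe₃, |α|)`).

So every profile-level theorem of the tree (Tsai 1998, the rotated head-pressure identity, Pineau–Vicol's weighted identities)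
now applies to stmt-16274 as stated, and the RSS Liouville problem in PV's open window acquires a first necessary condition
that is not a size condition: no "anti-cyclonic" (`α ω₃ ≤ 0`) or purely horizontal-vorticity (`ω₃ ≡ 0`) RSS profile exists.
-/

noncomputable section

open MeasureTheory Set Function Filter Topology InnerProductSpace Metric
open Literature.Analysis.FluidPDE Literature.Analysis.FluidPDE.PineauVicol2026
open scoped RealInnerProductSpace Laplacian ContDiff NNReal ENNReal

namespace Summit.NavierStokesRegularity.NavierStokesRegularity.Theorems.CorkscrewProfile.Birth

set_option linter.dupNamespace false

/-- **Co-rotation necessity with polynomially bounded pressure** (`ℝ³`, `ν = 1`, `a = ½`, rotation `α` about `e₃`): a smooth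
solution of Perelman's rotated Leray profile system with the profile Type-I decay, `|P y| ≤ M(1+‖y‖)^N`, and `α (curl U)₃ ≤ 0`
everywhere is trivial (wave 1's `rotatedLerayProfile_eq_zero_of_trace_nonneg` with `A = αJ`). [cite: Tsai1998, Theorem 1 (the case α = 0)] -/
theorem rotatedLerayProfile_eq_zero_of_counterRotating_poly {α C₀ M : ℝ} {N : ℕ}
    {U : EuclideanSpace ℝ (Fin 3) → EuclideanSpace ℝ (Fin 3)} {P : EuclideanSpace ℝ (Fin 3) → ℝ}
    (hU : ContDiff ℝ (⊤ : ℕ∞) U) (hP : ContDiff ℝ (⊤ : ℕ∞) P) (hdiv : VectorCalculus.IsDivFree U)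
    (heq : ∀ y : EuclideanSpace ℝ (Fin 3),
      α • (rotGen (U y) - fderiv ℝ U y (rotGen y)) + (1 / 2 : ℝ) • U y + (1 / 2 : ℝ) • fderiv ℝ U y y
        - (Δ U) y + fderiv ℝ U y (U y) + gradient P y = 0)
    (hdec : ∀ y : EuclideanSpace ℝ (Fin 3), ‖U y‖ ≤ C₀ / (1 + ‖y‖))
    (hPM : ∀ y : EuclideanSpace ℝ (Fin 3), |P y| ≤ M * (1 + ‖y‖) ^ N)
    (hsign : ∀ y : EuclideanSpace ℝ (Fin 3), α * (curl U y) 2 ≤ 0) : U = 0 := by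
  obtain ⟨-, hUb, hyU⟩ := bounds_of_profile_decay hdec
  have hU3 : ContDiff ℝ 3 U := hU.of_le (WithTop.coe_le_coe.2 le_top)
  have hP2 : ContDiff ℝ 2 P := hP.of_le (WithTop.coe_le_coe.2 le_top)
  have hUq : MemLp U 4 volume :=
    memLp_of_norm_mul_norm_le hU.continuous (R := 0) (fun y _ => hyU y) (by norm_num) (by simp)
  refine rotatedLerayProfile_eq_zero_of_trace_nonneg one_pos (by norm_num : (0 : ℝ) < 1 / 2) (α • rotGenL)
    (inner_smul_rotGenL_skew α) hU3 hP2 hdiv (rotatedProfile_eq_general heq) hUb hPM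
    (by norm_num : (1 : ℝ≥0∞) ≤ 4) (by simp) hUq fun y => ?_
  rw [traceCLM_smul_rotGenL_comp_fderiv]
  linarith [hsign y]

/-- **Every RSS field is a rotated Leray profile with polynomially bounded pressure.** From the data of `RssProfileExists`
(stmt-NavierStokesRegularity-16274) — `U ∈ C²`, `Rot` pinned on the standard basis, `u` ancient mild (ν = 1) with measurable
slices and Type-I constant `C₀`, `u(−1) = U`, and `u` rotated DSS for every factor `c > 0` through `Rot(−2α log c)` — the profile `U`
is smooth and divergence free, `‖U y‖ ≤ C₀/(1+‖y‖)`, and `(U, P)` solves Perelman's rotated profile system for a smooth pressure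
with `|P y| ≤ M(1+‖y‖)^N`: the Oseen-gauge representative is classical and equals the ansatz field `pvAnsatz α U` on the past
(`stub_rssDataClassical`), its backward similarity orbit is the rotating wave `(s,y) ↦ R(αs)U(R(−αs)y)` and solves the backward
Leray system (`isClassicalNSSolutionOn_Iio_iff_isBackwardLeraySolutionOn`, `lerayOrbit_pvAnsatz`), whence the profile system at
`s = 0` (`stub_rotatingWaveProfileEq`) with `P = q(−1)`, of polynomial growth (`stub_typeIPressureGrowth`).
[cite: PineauVicol2026, (1.7)–(1.8) and Lemma 2.1 (arXiv:2607.09619 pp. 3–4, 9)] -/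
theorem rssData_rotatedLerayProfile {α C₀ : ℝ} {U : EuclideanSpace ℝ (Fin 3) → EuclideanSpace ℝ (Fin 3)}
    {Rot : ℝ → (EuclideanSpace ℝ (Fin 3) ≃ₗᵢ[ℝ] EuclideanSpace ℝ (Fin 3))}
    {u : ℝ → EuclideanSpace ℝ (Fin 3) → EuclideanSpace ℝ (Fin 3)}
    (hRot : ∀ θ : ℝ, Rot θ (EuclideanSpace.single 0 1) = Real.cos θ • EuclideanSpace.single 0 1 + Real.sin θ • EuclideanSpace.single 1 1 ∧
      Rot θ (EuclideanSpace.single 1 1) = -(Real.sin θ • EuclideanSpace.single 0 1) + Real.cos θ • EuclideanSpace.single 1 1 ∧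
      Rot θ (EuclideanSpace.single 2 1) = EuclideanSpace.single 2 1)
    (hU2 : ContDiff ℝ 2 U) (hu1 : u (-1) = U)
    (hrss : ∀ c : ℝ, 0 < c → IsRotatedDSS c (Rot (-(α * (2 * Real.log c)))) u)
    (hmild : IsAncientMildSolution 1 u) (hmeas : ∀ t < 0, MeasureTheory.AEStronglyMeasurable (u t) MeasureTheory.volume)
    (hC : HasTypeIDecay C₀ u) :
    ∃ P : EuclideanSpace ℝ (Fin 3) → ℝ, ContDiff ℝ (⊤ : ℕ∞) U ∧ ContDiff ℝ (⊤ : ℕ∞) P ∧ VectorCalculus.IsDivFree U ∧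
      (∀ y : EuclideanSpace ℝ (Fin 3),
        α • (rotGen (U y) - fderiv ℝ U y (rotGen y)) + (1 / 2 : ℝ) • U y + (1 / 2 : ℝ) • fderiv ℝ U y y
          - (Δ U) y + fderiv ℝ U y (U y) + gradient P y = 0) ∧
      (∀ y : EuclideanSpace ℝ (Fin 3), ‖U y‖ ≤ C₀ / (1 + ‖y‖)) ∧
      ∃ (M : ℝ) (N : ℕ), ∀ y : EuclideanSpace ℝ (Fin 3), |P y| ≤ M * (1 + ‖y‖) ^ N := by
  obtain ⟨V, q, hV, hVI, hcl, hans, hV1⟩ := stub_rssDataClassical hRot hU2 hu1 hrss hmild hmeas hC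
  -- the backward similarity orbit of `V` is the rotating wave of `U`
  have hL := isClassicalNSSolutionOn_Iio_iff_isBackwardLeraySolutionOn.1 hcl
  have hwave : lerayOrbit V = fun s y => rotZ (α * s) (U (rotZ (-(α * s)) y)) := by
    funext s y
    have hs : -Real.exp (-s) < 0 := neg_neg_of_pos (Real.exp_pos _)
    have h1 : lerayOrbit V s y = lerayOrbit (pvAnsatz α (fun y _ => U y)) s y := by
      rw [lerayOrbit_apply, lerayOrbit_apply, hans _ hs]
    rw [h1, lerayOrbit_pvAnsatz]
  rw [hwave] at hL
  -- smoothness, incompressibility and decay of the slice `U = V(−1)`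
  have hneg : (-1 : ℝ) < 0 := by norm_num
  have hUinf : ContDiff ℝ (⊤ : ℕ∞) U := hV1 ▸ hV.contDiff_slice hneg
  have hdivU : VectorCalculus.IsDivFree U := hV1 ▸ hV.2.1 (-1) hneg
  have hdecU : ∀ y : EuclideanSpace ℝ (Fin 3), ‖U y‖ ≤ C₀ / (1 + ‖y‖) := fun y => by
    have h := hVI (-1) hneg y
    rw [hV1, neg_neg, Real.sqrt_one, add_comm] at h
    exact h
  -- the profile system at `s = 0`, pressure `q(−1)`
  have heq := stub_rotatingWaveProfileEq hUinf hL
  have hP0 : lerayOrbitPressure q 0 = q (-1) := by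
    funext y
    rw [lerayOrbitPressure_apply]
    simp
  rw [hP0] at heq
  -- polynomial growth of `q(−1)`
  have hIcl : ∀ t ∈ Iio (0 : ℝ), ∀ x : EuclideanSpace ℝ (Fin 3), ‖V t x‖ ≤ C₀ / (‖x‖ + Real.sqrt (-t)) :=
    fun t ht x => hVI t ht x
  obtain ⟨A, hA⟩ := stub_typeIPressureGrowth hcl hIcl
  refine ⟨q (-1), hUinf, hcl.contDiff_pressure (mem_Iio.2 hneg), hdivU, heq, hdecU, A + |q (-1) 0|, 4, fun y => ?_⟩
  have h1 := hA y
  have h2 : (1 : ℝ) ≤ (1 + ‖y‖) ^ 4 := one_le_pow₀ (by linarith [norm_nonneg y])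
  have h3 : |q (-1) y| ≤ |q (-1) y - q (-1) 0| + |q (-1) 0| := by
    have := abs_add_le (q (-1) y - q (-1) 0) (q (-1) 0)
    rwa [sub_add_cancel] at this
  have h4 : |q (-1) 0| ≤ |q (-1) 0| * (1 + ‖y‖) ^ 4 := le_mul_of_one_le_right (abs_nonneg _) h2
  calc |q (-1) y| ≤ A * (1 + ‖y‖) ^ 4 + |q (-1) 0| * (1 + ‖y‖) ^ 4 := by linarith
    _ = (A + |q (-1) 0|) * (1 + ‖y‖) ^ 4 := by ring

/-- **Every nontrivial RSS field has co-rotating vertical vorticity somewhere**: under the data of `RssProfileExists` with `U ≠ 0`,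
there is a point with `α · (curl U)₃ > 0` (`rssData_rotatedLerayProfile` + `rotatedLerayProfile_eq_zero_of_counterRotating_poly`).
[cite: Tsai1998, Theorem 1 (the case α = 0)] -/
theorem rssData_exists_corotating_vorticity {α C₀ : ℝ} {U : EuclideanSpace ℝ (Fin 3) → EuclideanSpace ℝ (Fin 3)}
    {Rot : ℝ → (EuclideanSpace ℝ (Fin 3) ≃ₗᵢ[ℝ] EuclideanSpace ℝ (Fin 3))}
    {u : ℝ → EuclideanSpace ℝ (Fin 3) → EuclideanSpace ℝ (Fin 3)}
    (hRot : ∀ θ : ℝ, Rot θ (EuclideanSpace.single 0 1) = Real.cos θ • EuclideanSpace.single 0 1 + Real.sin θ • EuclideanSpace.single 1 1 ∧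
      Rot θ (EuclideanSpace.single 1 1) = -(Real.sin θ • EuclideanSpace.single 0 1) + Real.cos θ • EuclideanSpace.single 1 1 ∧
      Rot θ (EuclideanSpace.single 2 1) = EuclideanSpace.single 2 1)
    (hU2 : ContDiff ℝ 2 U) (hU0 : U ≠ 0) (hu1 : u (-1) = U)
    (hrss : ∀ c : ℝ, 0 < c → IsRotatedDSS c (Rot (-(α * (2 * Real.log c)))) u)
    (hmild : IsAncientMildSolution 1 u) (hmeas : ∀ t < 0, MeasureTheory.AEStronglyMeasurable (u t) MeasureTheory.volume)
    (hC : HasTypeIDecay C₀ u) :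
    ∃ y : EuclideanSpace ℝ (Fin 3), 0 < α * (curl U y) 2 := by
  obtain ⟨P, hU, hP, hdiv, heq, hdec, M, N, hPM⟩ := rssData_rotatedLerayProfile hRot hU2 hu1 hrss hmild hmeas hC
  by_contra h
  push Not at h
  exact hU0 (rotatedLerayProfile_eq_zero_of_counterRotating_poly hU hP hdiv heq hdec hPM h)

/-- **Assembly T11 `rssProfileExists_rotatedLerayProfile`** (registered theorem of crux stmt-NavierStokesRegularity-11282, line
`registered`, skeleton v11). `RssProfileExists` (stmt-16274) implies: there are `α ≠ 0`, `C₀`, a smooth nontrivial divergence-free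
`U` with `‖U y‖ ≤ C₀/(1+‖y‖)` and a smooth `P` with `|P y| ≤ M(1+‖y‖)^N` solving Perelman's rotated Leray profile system, and a point
where `α (curl U)₃ > 0` — the RSS profile of Pineau–Vicol's open window, if it exists, is a rotated Leray profile whose vertical
vorticity co-rotates with the pattern somewhere. [cite: PineauVicol2026, Conjecture 1.1 and (1.8) (arXiv:2607.09619 pp. 3–4)] -/
theorem rssProfileExists_rotatedLerayProfile
    (h : Summit.NavierStokesRegularity.NavierStokesRegularity.Theses.FilamentSkeletonRss.RssProfileExists) :
    ∃ (α C₀ M : ℝ) (N : ℕ) (U : EuclideanSpace ℝ (Fin 3) → EuclideanSpace ℝ (Fin 3)) (P : EuclideanSpace ℝ (Fin 3) → ℝ),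
      α ≠ 0 ∧ U ≠ 0 ∧ ContDiff ℝ (⊤ : ℕ∞) U ∧ ContDiff ℝ (⊤ : ℕ∞) P ∧ VectorCalculus.IsDivFree U ∧
      (∀ y : EuclideanSpace ℝ (Fin 3),
        α • (rotGen (U y) - fderiv ℝ U y (rotGen y)) + (1 / 2 : ℝ) • U y + (1 / 2 : ℝ) • fderiv ℝ U y y
          - (Δ U) y + fderiv ℝ U y (U y) + gradient P y = 0) ∧
      (∀ y : EuclideanSpace ℝ (Fin 3), ‖U y‖ ≤ C₀ / (1 + ‖y‖)) ∧
      (∀ y : EuclideanSpace ℝ (Fin 3), |P y| ≤ M * (1 + ‖y‖) ^ N) ∧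
      ∃ y : EuclideanSpace ℝ (Fin 3), 0 < α * (curl U y) 2 := by
  obtain ⟨α, C₀, U, Rot, u, hα, hRot, hU2, hU0, hu1, hrss, hmild, hmeas, hC⟩ := h
  obtain ⟨P, hU, hP, hdiv, heq, hdec, M, N, hPM⟩ := rssData_rotatedLerayProfile hRot hU2 hu1 hrss hmild hmeas hC
  exact ⟨α, C₀, M, N, U, P, hα, hU0, hU, hP, hdiv, heq, hdec, hPM,
    rssData_exists_corotating_vorticity hRot hU2 hU0 hu1 hrss hmild hmeas hC⟩

/-- **Co-rotation necessity for the open stub, contrapositive packaging.** If NO smooth rotated Leray profile with the Type-I profile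
decay, polynomially bounded pressure and a co-rotating point exists, then `RssProfileExists` fails — the form in which a Liouville
theorem "off the co-rotation ball" would refute stmt-16274. [cite: PineauVicol2026, Conjecture 1.1 (arXiv:2607.09619 p. 3)] -/
theorem not_rssProfileExists_of_no_corotating_profile
    (h : ∀ (α C₀ M : ℝ) (N : ℕ) (U : EuclideanSpace ℝ (Fin 3) → EuclideanSpace ℝ (Fin 3)) (P : EuclideanSpace ℝ (Fin 3) → ℝ),
      α ≠ 0 → ContDiff ℝ (⊤ : ℕ∞) U → ContDiff ℝ (⊤ : ℕ∞) P → VectorCalculus.IsDivFree U →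
      (∀ y : EuclideanSpace ℝ (Fin 3),
        α • (rotGen (U y) - fderiv ℝ U y (rotGen y)) + (1 / 2 : ℝ) • U y + (1 / 2 : ℝ) • fderiv ℝ U y y
          - (Δ U) y + fderiv ℝ U y (U y) + gradient P y = 0) →
      (∀ y : EuclideanSpace ℝ (Fin 3), ‖U y‖ ≤ C₀ / (1 + ‖y‖)) →
      (∀ y : EuclideanSpace ℝ (Fin 3), |P y| ≤ M * (1 + ‖y‖) ^ N) → U = 0) :
    ¬ Summit.NavierStokesRegularity.NavierStokesRegularity.Theses.FilamentSkeletonRss.RssProfileExists := by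
  intro hR
  obtain ⟨α, C₀, M, N, U, P, hα, hU0, hU, hP, hdiv, heq, hdec, hPM, -⟩ := rssProfileExists_rotatedLerayProfile hR
  exact hU0 (h α C₀ M N U P hα hU hP hdiv heq hdec hPM)

end Summit.NavierStokesRegularity.NavierStokesRegularity.Theorems.CorkscrewProfile.Birth
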